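import Literature.NumberTheory.LFunctions.Zhang2022.Section8ProfilePairTerms
import HarnessLib

/-!
# Zhang (2022) §8 for profile data: THE BILINEAR ROW (S) FOR TWO `C²` SHORT PIECES —
# `α⁻¹S_j(𝐚_u, conj 𝐚_v) = 𝔪_j(u,v)·𝔞 + o(𝔞)` under (A), for every `c′`, `j = 1,2,3`, lengths `θ_u, θ_v ∈ (0,1)`

Topic `Literature/NumberTheory/LFunctions/Zhang2022` (Landau–Siegel audit tree; verdict-neutral). Y. Zhang, *Discrete mean
estimates and the Landau–Siegel zero*, arXiv:2211.02515v1 (2022) [Zhang2022LandauSiegel] — **an unrefereed manuscript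
under adjudication; nothing here asserts or denies its Theorems 1–2; no claim about Landau–Siegel zeros.** Cell
landau-siegel §D, crux K0 = stmt-Parity-20459 `InClassSideTablesPiece` (line «sjrows»), prover ls-knife-K0-p1 g3.

The diagonal row `Section8ProfileSjRow.sjProfileRow_C2` evaluates `S_j(𝐚_u, conj 𝐚_u)`; this file evaluates the OFF-DIAGONAL
`S_j(𝐚_u, conj 𝐚_v)` for two `C²` short pieces `u, v` of (possibly different) lengths `θ_u, θ_v ∈ (0,1)`:

* `sjPairMain j u u′ v v′ = −π⁻¹∫₀¹ 𝔧_j(u;z)·𝔪(bS j, bN j; v̄)(z) dz` (= `sjProfileMain j u u′` on the diagonal, `rfl`);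
* `SjPairRow c′ j u u′ v v′` (shape, asserted by no one; = `SjProfileRow c′ j u u′` on the diagonal, `Iff.rfl`);
* **`sjPairRow_C2`** — the row holds for every `c′`, every `j ∈ {1,2,3}` and every pair of `C²` short pieces.

Mechanism (Zhang's (8.9)–(8.12) for two general profiles in place of `ϰ₁, ϰ₂`): the product `M_j(n)[u]·N_j(d,r)[v]` is
supported on `n = dr < P^{θ₀}`, `θ₀ = min(θ_u,θ_v)`; on the good range `n < P^{θ₀}/T²` both pointwise rows (LEMMA A
`psi_main_bound` for `u`, LEMMA A* `anti_main_bound` for `v`) apply (`good_range_pair_bound`); the sliver `[P^{θ₀}/T², P^{θ₀})`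
is small in each of the three cases `θ_u = θ_v` (both inner sums crude-small), `θ_u < θ_v` (`M_j[u]` crude-small, `N_j[v]` of
main size), `θ_v < θ_u` (symmetrically) — `Section8ProfilePairTerms.sliverPair_bound`, margin `𝓛⁻¹`; then (8.10), the engine with
`F = Φ(log t/Λ)`, `Φ = jetEx(u)·massEx(v̄)` (`Section8ProfilePairCalc`), the substitution `t = e^{zΛ}` and the jets dictionary.

## References
* Y. Zhang, arXiv:2211.02515v1 (2022), §7 Prop 7.1; §8 Lemmas 8.2–8.4, (8.10)–(8.12), pp. 47–48.
  [cite: Zhang2022LandauSiegel, §8 pp.47–48]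
-/

noncomputable section

open Complex Real MeasureTheory Set intervalIntegral Filter Finset
open scoped ComplexConjugate Topology

namespace Literature.NumberTheory.LFunctions.Zhang2022.DipoleRule

open Skeleton KnifeEdge

/-! ### The bilinear main-term constant and the row (S) for a pair -/

/-- **The bilinear main-term constant `𝔪_j(u,v) := −π⁻¹∫₀¹ 𝔧_j(u;z)·𝔪(bS j, bN j; v̄)(z) dz`** — LEMMA A's jet of the ψ-side
piece `u` against LEMMA A*'s mass rule of the conjugate anti-side piece `v̄`. [cite: Zhang2022LandauSiegel, §8 (8.10)–(8.12)] -/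
def sjPairMain (j : ℕ) (u u' v v' : ℝ → ℂ) : ℂ :=
  -(((1 / π : ℝ)) : ℂ) * ∫ z in (0:ℝ)..1,
    k0jet j u u' z * k0mass (Repair.bS j) (Repair.bN j) (fun t => conj (v t)) (fun t => conj (v' t)) z

/-- **BILINEAR ROW (S) (shape, asserted by no one):** under (A), eventually in `D`,
`‖α⁻¹·S_j(𝐚_u, conj 𝐚_v) − 𝔪_j(u,v)·𝔞‖ ≤ ε𝔞`. [cite: Zhang2022LandauSiegel, §8 (8.9)–(8.12), Lemmas 8.2–8.4] -/
def SjPairRow (c' : ℝ) (j : ℕ) (u u' v v' : ℝ → ℂ) : Prop :=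
  ∀ ε : ℝ, 0 < ε → ForAllLarge fun D _ χ => AssumptionA D χ →
    ‖(alpha D : ℂ)⁻¹ * Sj c' D j (profTable u D χ) (fun n => conj (profTable v D χ n))
        - sjPairMain j u u' v v' * frakA χ‖ ≤ ε * frakA χ

/-- On the diagonal the bilinear constant is `𝔪_j(u)`. [cite: Zhang2022LandauSiegel, §8 (8.10)–(8.12)] -/
theorem sjPairMain_self (j : ℕ) (u u' : ℝ → ℂ) : sjPairMain j u u' u u' = sjProfileMain j u u' := rfl

/-- On the diagonal the bilinear row is the row (S). [cite: Zhang2022LandauSiegel, §8 (8.9)–(8.12)] -/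
theorem sjPairRow_self (c' : ℝ) (j : ℕ) (u u' : ℝ → ℂ) : SjPairRow c' j u u' u u' ↔ SjProfileRow c' j u u' := Iff.rfl

/-! ### The theorem -/

/-- Threshold bookkeeping: `K/c ≤ ℓ` (with `c, ℓ > 0`, `K ≥ 0`) gives `K/ℓ ≤ c`. [folklore] -/
private theorem div_le_of_div_le' {K c ℓ : ℝ} (hc : 0 < c) (hℓ : 0 < ℓ) (h : K / c ≤ ℓ) : K / ℓ ≤ c := by
  rw [div_le_iff₀ hℓ]
  rw [div_le_iff₀ hc] at h
  nlinarith

set_option maxHeartbeats 1600000 in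
/-- **BILINEAR ROW (S) FOR TWO `C²` SHORT PIECES.** For every `c′`, every `j ∈ {1,2,3}`, and every two profiles `u`, `v` with
lengths `θ_u, θ_v ∈ (0,1)` — `u, u′, u″` continuous on `[0,θ_u]`, `HasDerivAt u (u′ y) y` and `HasDerivAt u′ (u″ y) y` for
`y < θ_u`, `u = 0` on `[θ_u,∞)`, `u′ = 0` on `(θ_u,∞)`, and likewise for `v` on `[0,θ_v]` —: `SjPairRow c′ j u u′ v v′`,
i.e. under (A), eventually in `D`, `‖α⁻¹S_j(𝐚_u, conj 𝐚_v) − 𝔪_j(u,v)·𝔞‖ ≤ ε𝔞`.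
[cite: Zhang2022LandauSiegel, §8 Lemmas 8.2–8.4, (8.10)–(8.12), pp.47–48] -/
theorem sjPairRow_C2 (c' : ℝ) {u u' u'' v v' v'' : ℝ → ℂ} {θu θv : ℝ} (hθu0 : 0 < θu) (hθu1 : θu < 1)
    (hθv0 : 0 < θv) (hθv1 : θv < 1)
    (hu : ContinuousOn u (Icc 0 θu)) (hu' : ContinuousOn u' (Icc 0 θu)) (hu'' : ContinuousOn u'' (Icc 0 θu))
    (hdu : ∀ y : ℝ, y < θu → HasDerivAt u (u' y) y) (hdu' : ∀ y : ℝ, y < θu → HasDerivAt u' (u'' y) y)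
    (huvan : ∀ y : ℝ, θu ≤ y → u y = 0) (huvan' : ∀ y : ℝ, θu < y → u' y = 0)
    (hv : ContinuousOn v (Icc 0 θv)) (hv' : ContinuousOn v' (Icc 0 θv)) (hv'' : ContinuousOn v'' (Icc 0 θv))
    (hdv : ∀ y : ℝ, y < θv → HasDerivAt v (v' y) y) (hdv' : ∀ y : ℝ, y < θv → HasDerivAt v' (v'' y) y)
    (hvvan : ∀ y : ℝ, θv ≤ y → v y = 0) (hvvan' : ∀ y : ℝ, θv < y → v' y = 0) {j : ℕ}
    (hj : j ∈ ({1, 2, 3} : Finset ℕ)) : SjPairRow c' j u u' v v' := by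
  intro ε hε
  set θ₀ : ℝ := min θu θv with hmin
  have hθ0 : 0 < θ₀ := lt_min hθu0 hθv0
  have h0u : θ₀ ≤ θu := min_le_left _ _
  have h0v : θ₀ ≤ θv := min_le_right _ _
  have hθ01 : θ₀ < 1 := lt_of_le_of_lt h0u hθu1
  -- profile bounds (common constants for both pieces)
  obtain ⟨b₀, hb₀⟩ := isCompact_Icc.exists_bound_of_continuousOn hu
  obtain ⟨b₁, hb₁⟩ := isCompact_Icc.exists_bound_of_continuousOn hu'
  obtain ⟨b₂, hb₂⟩ := isCompact_Icc.exists_bound_of_continuousOn hu''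
  obtain ⟨d₀, hd₀⟩ := isCompact_Icc.exists_bound_of_continuousOn hv
  obtain ⟨d₁, hd₁⟩ := isCompact_Icc.exists_bound_of_continuousOn hv'
  obtain ⟨d₂, hd₂⟩ := isCompact_Icc.exists_bound_of_continuousOn hv''
  have hB00 : 0 ≤ max (max b₀ d₀) 0 := le_max_right _ _
  have hB10 : 0 ≤ max (max b₁ d₁) 0 := le_max_right _ _
  have hB20 : 0 ≤ max (max b₂ d₂) 0 := le_max_right _ _
  have hB0u : ∀ y ∈ Icc 0 θu, ‖u y‖ ≤ max (max b₀ d₀) 0 :=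
    fun y hy => (hb₀ y hy).trans ((le_max_left _ _).trans (le_max_left _ _))
  have hB1u : ∀ y ∈ Icc 0 θu, ‖u' y‖ ≤ max (max b₁ d₁) 0 :=
    fun y hy => (hb₁ y hy).trans ((le_max_left _ _).trans (le_max_left _ _))
  have hB2u : ∀ y ∈ Icc 0 θu, ‖u'' y‖ ≤ max (max b₂ d₂) 0 :=
    fun y hy => (hb₂ y hy).trans ((le_max_left _ _).trans (le_max_left _ _))
  have hB0v : ∀ y ∈ Icc 0 θv, ‖v y‖ ≤ max (max b₀ d₀) 0 :=
    fun y hy => (hd₀ y hy).trans ((le_max_right _ _).trans (le_max_left _ _))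
  have hB1v : ∀ y ∈ Icc 0 θv, ‖v' y‖ ≤ max (max b₁ d₁) 0 :=
    fun y hy => (hd₁ y hy).trans ((le_max_right _ _).trans (le_max_left _ _))
  have hB2v : ∀ y ∈ Icc 0 θv, ‖v'' y‖ ≤ max (max b₂ d₂) 0 :=
    fun y hy => (hd₂ y hy).trans ((le_max_right _ _).trans (le_max_left _ _))
  generalize max (max b₀ d₀) 0 = B₀ at hB00 hB0u hB0v
  generalize max (max b₁ d₁) 0 = B₁ at hB10 hB1u hB1v
  generalize max (max b₂ d₂) 0 = B₂ at hB20 hB2u hB2v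
  -- the one-sided derivative hypotheses of the rows
  have hdWu : ∀ y ∈ Ioo 0 θu, HasDerivWithinAt u (u' y) (Ioi y) y := fun y hy => (hdu y hy.2).hasDerivWithinAt
  have hdWu' : ∀ y ∈ Ioo 0 θu, HasDerivWithinAt u' (u'' y) (Ioi y) y := fun y hy => (hdu' y hy.2).hasDerivWithinAt
  have hdWv : ∀ y ∈ Ioo 0 θv, HasDerivWithinAt v (v' y) (Ioi y) y := fun y hy => (hdv y hy.2).hasDerivWithinAt
  have hdWv' : ∀ y ∈ Ioo 0 θv, HasDerivWithinAt v' (v'' y) (Ioi y) y := fun y hy => (hdv' y hy.2).hasDerivWithinAt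
  have hdIu : ∀ y ∈ Ico 0 θu, HasDerivAt u (u' y) y := fun y hy => hdu y hy.2
  have hdIv : ∀ y ∈ Ico 0 θv, HasDerivAt v (v' y) y := fun y hy => hdv y hy.2
  have hBuz : ∀ z ∈ Icc 0 θu, ‖u z‖ ≤ B₁ * (θu - z) :=
    fun z hz => norm_le_mul_sub_of_vanish hu hdIu (huvan θu le_rfl) hB1u hz
  have hBvz : ∀ z ∈ Icc 0 θv, ‖v z‖ ≤ B₁ * (θv - z) :=
    fun z hz => norm_le_mul_sub_of_vanish hv hdIv (hvvan θv le_rfl) hB1v hz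
  -- the tree inputs
  obtain ⟨C84raw, h84⟩ := lemma84Rel_holds c'
  obtain ⟨Cξ, hCξ0, hξ⟩ := xiZeroLogMean_le c'
  obtain ⟨Ceng, heng⟩ := Section8RangeEngine.weighted_sum_integral_eval c'
  obtain ⟨a₀, ha₀, hAlow⟩ := frakALowerBound_holds
  have hC840 : 0 ≤ max C84raw 0 := le_max_right _ _
  -- the constants
  have hG0 : 0 ≤ Gbound c' := (Gbound_pos c').le
  have hC820 : 0 ≤ Lemma82.C82 0 := by
    unfold Lemma82.C82; have := Lemma82.I0_nonneg; positivity
  obtain ⟨KE, hKEdef, hKE0⟩ : ∃ KE : ℝ, KE = ((Lemma82.C82 0 * ((Gbound c' + 1) ^ 2 * (B₀ + B₁ + B₂))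
            + (Gbound c' + 1) ^ 2 * (B₀ + B₁ + B₂) * (2 + 4 * Real.exp (9 / 2)))
          * (4 * Real.exp (9 / 2) * (B₁ + 2 * Gbound c' * B₀ + Gbound c' ^ 2 * (B₀ * θv))
            + (max C84raw 0 * ((1 + (3 * π / 2 + 1) ^ 2) * (B₀ + B₁ + B₂))
              + 2 * ((3 * π / 2 + 1) ^ 2 * (B₀ + B₁ + B₂))
                * (108 * Cξ + 4 * Real.exp (9 / 2) *
                  (1 + 2 * (Gbound c' ^ 2 / (3 * π / 2) ^ 2) + 2 * ((Gbound c' + 3 * π / 2) ^ 2 / (3 * π / 2))))))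
        + 4 * Real.exp (9 / 2) * (Gbound c' * B₀ + B₁) *
          (max C84raw 0 * ((1 + (3 * π / 2 + 1) ^ 2) * (B₀ + B₁ + B₂))
            + 2 * ((3 * π / 2 + 1) ^ 2 * (B₀ + B₁ + B₂))
              * (108 * Cξ + 4 * Real.exp (9 / 2) *
                (1 + 2 * (Gbound c' ^ 2 / (3 * π / 2) ^ 2) + 2 * ((Gbound c' + 3 * π / 2) ^ 2 / (3 * π / 2)))))) ∧
      0 ≤ KE := ⟨_, rfl, by positivity⟩
  obtain ⟨KS, hKSdef, hKS0⟩ : ∃ KS : ℝ, KS = (8 * 3 ^ 5 * Real.exp 430 / π * B₁ ^ 2 * Cξ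
          + 36 * Real.exp 430 / π * B₁ *
              (4 * Real.exp (9 / 2) * (B₁ + 2 * Gbound c' * B₀ + Gbound c' ^ 2 * (B₀ * θv))
                + (max C84raw 0 * ((1 + (3 * π / 2 + 1) ^ 2) * (B₀ + B₁ + B₂))
                  + 2 * ((3 * π / 2 + 1) ^ 2 * (B₀ + B₁ + B₂))
                    * (108 * Cξ + 4 * Real.exp (9 / 2) *
                      (1 + 2 * (Gbound c' ^ 2 / (3 * π / 2) ^ 2) + 2 * ((Gbound c' + 3 * π / 2) ^ 2 / (3 * π / 2))))))
          + 324 * Real.exp 430 / π * B₁ * Cξ *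
              (4 * Real.exp (9 / 2) * (Gbound c' * B₀ + B₁)
                + (Lemma82.C82 0 * ((Gbound c' + 1) ^ 2 * (B₀ + B₁ + B₂))
                  + (Gbound c' + 1) ^ 2 * (B₀ + B₁ + B₂) * (2 + 4 * Real.exp (9 / 2))))) ∧ 0 ≤ KS :=
    ⟨_, rfl, by positivity⟩
  obtain ⟨Keng, hKengdef, hKeng0⟩ : ∃ Keng : ℝ, Keng = |Ceng| / π *
      ((Gbound c' * B₀ + B₁) * (B₁ + 2 * Gbound c' * B₀ + Gbound c' ^ 2 * (B₀ * θv))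
        + ((Gbound c' * B₁ + B₂) * (B₁ + 2 * Gbound c' * B₀ + Gbound c' ^ 2 * (B₀ * θv))
          + (Gbound c' * B₀ + B₁) * (B₂ + 2 * Gbound c' * B₁ + Gbound c' ^ 2 * B₀))) ∧ 0 ≤ Keng :=
    ⟨_, rfl, by positivity⟩
  obtain ⟨Kjet, hKjetdef, hKjet0⟩ : ∃ Kjet : ℝ, Kjet = (15 * π * |c'| * π * B₀ *
      (B₁ + 2 * Gbound c' * B₀ + Gbound c' ^ 2 * (B₀ * θv))
          + (B₁ + π * j * B₀) * (30 * π * |c'| * π * B₀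
              + 9 * π ^ 2 * (10 * |c'| * π + 25 * c' ^ 2 * π ^ 2) * (B₀ * θv))) * θ₀ / π ∧ 0 ≤ Kjet :=
    ⟨_, rfl, by positivity⟩
  obtain ⟨Ktail, hKtaildef, hKtail0⟩ : ∃ Ktail : ℝ, Ktail = 2 * ((Gbound c' * B₀ + B₁)
      * (B₁ + 2 * Gbound c' * B₀ + Gbound c' ^ 2 * (B₀ * θv))) / π ∧ 0 ≤ Ktail := ⟨_, rfl, by positivity⟩
  -- threshold (a sum of nonnegative thresholds dominates each of them)
  have h1θu : 0 < 1 - θu := by linarith only [hθu1]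
  have h1θv : 0 < 1 - θv := by linarith only [hθv1]
  have hεa : 0 < ε / 5 * a₀ := by positivity
  have hε5 : 0 < ε / 5 := by positivity
  have ht1 : 0 ≤ 4 * Real.exp 430 / π * KE / (ε / 5 * a₀) := by positivity
  have ht2 : 0 ≤ KS / (ε / 5 * a₀) := by positivity
  have ht3 : 0 ≤ Keng / (ε / 5 * a₀) := by positivity
  have ht4 : 0 ≤ Kjet / (ε / 5) := by positivity
  have ht5 : 0 ≤ Ktail / (ε / 5) := by positivity
  have ht6 : 0 ≤ 4 / θ₀ := by positivity
  have ht7 : 0 ≤ 2 / (1 - θu) + 1 := by positivity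
  have ht8 : 0 ≤ 2 / (1 - θv) + 1 := by positivity
  have ht9 : 0 ≤ 2 / |θu - θv| := by positivity
  obtain ⟨L₀, hL₀⟩ : ∃ L₀ : ℝ, L₀ = 4 + 4 / θ₀ + (2 / (1 - θu) + 1) + (2 / (1 - θv) + 1) + 2 / |θu - θv|
      + 4 * Real.exp 430 / π * KE / (ε / 5 * a₀)
      + KS / (ε / 5 * a₀) + Keng / (ε / 5 * a₀) + Kjet / (ε / 5) + Ktail / (ε / 5) := ⟨_, rfl⟩
  have hLbig : ForAllLarge fun D _ _ => L₀ ≤ Real.log D :=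
    ForAllLarge.of_le ⌈Real.exp L₀⌉₊ fun D _ _ hD _ _ => le_log_of_ceil_exp_le hD
  refine ((((h84.and hξ).and heng).and hAlow).and hLbig).mono ?_
  intro D _ χ hq hp ⟨⟨⟨⟨h84D, hξD⟩, hengD⟩, hAD⟩, hLD⟩ hA
  have hL4 : 4 ≤ Real.log D := by linarith only [hLD, hL₀, ht1, ht2, ht3, ht4, ht5, ht6, ht7, ht8, ht9]
  have hLθ : 4 / θ₀ ≤ Real.log D := by linarith only [hLD, hL₀, ht1, ht2, ht3, ht4, ht5, ht6, ht7, ht8, ht9]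
  have hL1θu : 2 / (1 - θu) + 1 ≤ Real.log D := by
    linarith only [hLD, hL₀, ht1, ht2, ht3, ht4, ht5, ht6, ht7, ht8, ht9]
  have hL1θv : 2 / (1 - θv) + 1 ≤ Real.log D := by
    linarith only [hLD, hL₀, ht1, ht2, ht3, ht4, ht5, ht6, ht7, ht8, ht9]
  have hTgap : 2 / |θu - θv| ≤ Real.log D := by
    linarith only [hLD, hL₀, ht1, ht2, ht3, ht4, ht5, ht6, ht7, ht8, ht9]
  have hT1 : 4 * Real.exp 430 / π * KE / (ε / 5 * a₀) ≤ Real.log D := by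
    linarith only [hLD, hL₀, ht1, ht2, ht3, ht4, ht5, ht6, ht7, ht8, ht9]
  have hT2 : KS / (ε / 5 * a₀) ≤ Real.log D := by
    linarith only [hLD, hL₀, ht1, ht2, ht3, ht4, ht5, ht6, ht7, ht8, ht9]
  have hT3 : Keng / (ε / 5 * a₀) ≤ Real.log D := by
    linarith only [hLD, hL₀, ht1, ht2, ht3, ht4, ht5, ht6, ht7, ht8, ht9]
  have hT4 : Kjet / (ε / 5) ≤ Real.log D := by linarith only [hLD, hL₀, ht1, ht2, ht3, ht4, ht5, ht6, ht7, ht8, ht9]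
  have hT5 : Ktail / (ε / 5) ≤ Real.log D := by linarith only [hLD, hL₀, ht1, ht2, ht3, ht4, ht5, ht6, ht7, ht8, ht9]
  -- scales
  have hL3 : 3 ≤ Real.log D := by linarith only [hL4]
  have hℓ1 : 1 ≤ Real.log D := by linarith only [hL4]
  have hℓ0 : 0 < Real.log D := by linarith only [hL4]
  have hLθu : 4 / θu ≤ Real.log D := (div_le_div_of_nonneg_left (by norm_num) hθ0 h0u).trans hLθ
  have hLθv : 4 / θv ≤ Real.log D := (div_le_div_of_nonneg_left (by norm_num) hθ0 h0v).trans hLθ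
  have hL1θ0 : 2 / (1 - θ₀) + 1 ≤ Real.log D := by
    have : 2 / (1 - θ₀) ≤ 2 / (1 - θu) := div_le_div_of_nonneg_left (by norm_num) h1θu (by linarith only [h0u])
    linarith only [this, hL1θu]
  obtain ⟨hτθ, hY2, hYP, hlogY1, hθ0N, h2L⟩ := scales_large hθ0 hθ01 hL4 hLθ hL1θ0
  obtain ⟨-, -, -, -, hθuN, -⟩ := scales_large hθu0 hθu1 hL4 hLθu hL1θu
  obtain ⟨-, -, -, -, hθvN, -⟩ := scales_large hθv0 hθv1 hL4 hLθv hL1θv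
  have hΛ0 : 0 < Real.log D ^ 9 := by positivity
  have hL1pos : 0 < Real.log D ^ (11 / 10 : ℝ) := Real.rpow_pos_of_pos hℓ0 _
  have hτ0 : 0 ≤ 2 * Real.log D ^ (11 / 10 : ℝ) / Real.log D ^ 9 := by positivity
  have hY1 : 1 ≤ Real.exp ((θ₀ - 2 * Real.log D ^ (11 / 10 : ℝ) / Real.log D ^ 9) * Real.log D ^ 9) := by
    linarith only [hY2]
  have hYX : Real.exp ((θ₀ - 2 * Real.log D ^ (11 / 10 : ℝ) / Real.log D ^ 9) * Real.log D ^ 9)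
      ≤ Real.exp (θ₀ * Real.log D ^ 9) := by
    rw [Real.exp_le_exp, sub_mul]
    linarith only [mul_nonneg hτ0 hΛ0.le]
  have hA' : ‖χ.LFunction 1‖ ≤ 1 / Real.log D ^ 2022 := le_of_lt hA
  have ha₀le : a₀ ≤ frakA χ := hAD hA
  have hfrakA0 : 0 ≤ frakA χ := ha₀.le.trans ha₀le
  -- the gap between the two lengths, when they differ
  have hgapB : θu < θv → 2 * Real.log D ^ (11 / 10 : ℝ) / Real.log D ^ 9 ≤ θv - θu := by
    intro hlt
    have hg : 0 < θv - θu := sub_pos.mpr hlt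
    have h2 : 2 / (θv - θu) ≤ Real.log D := by rwa [abs_sub_comm, abs_of_pos hg] at hTgap
    exact (gap_scales hℓ1 hg h2).1
  have hgapC : θv < θu → Real.log D ^ (11 / 10 : ℝ) / Real.log D ^ 9 ≤ θu - θv := by
    intro hgt
    have hg : 0 < θu - θv := sub_pos.mpr hgt
    have h2 : 2 / (θu - θv) ≤ Real.log D := by rwa [abs_of_pos hg] at hTgap
    exact (gap_scales hℓ1 hg h2).2
  -- Lemma 8.4's content at this modulus, μ = 6, for every `dr ≤ P^{θ₀}` (`< ⌈PT⁻²⌉`)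
  have h84all : ∀ d r : ℕ, 1 ≤ d → 1 ≤ r → ((d * r : ℕ) : ℝ) ≤ Real.exp (θ₀ * Real.log D ^ 9) →
      ∀ y : ℝ, bigT D < y → y < bigP D →
      ‖(∑ n ∈ Finset.Ico 1 ⌈y⌉₊, χ (n : ZMod D) * xiZero c' D j n d r / (n : ℂ) *
            ((y / n : ℝ) : ℂ) ^ (-betaMu D 6) * (Real.log (y / n) : ℂ)) -
          deriv χ.LFunction 1 * PiW χ d r * frakgW c' D j 6 y‖
        ≤ max C84raw 0 * (Real.log D ^ 6)⁻¹ * (∏ q ∈ (d * r).primeFactors, (1 - (q : ℝ)⁻¹)⁻¹) ^ 2 := by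
    intro d r hd1 hr1 hdr y hy1 hy2
    have hdrN : ((d * r : ℕ) : ℝ) < bigP D / bigT D ^ 2 := by
      have h1 : ((d * r : ℕ) : ℝ) < (Nsupp D : ℝ) := lt_of_le_of_lt hdr hθ0N
      have h2 : d * r < Nsupp D := by exact_mod_cast h1
      exact Nat.lt_ceil.mp h2
    have h := h84D hA j hj 6 (by simp) d r hd1 hr1 hdrN y hy1 hy2
    refine h.trans ?_
    have : C84raw * (ell D ^ 6)⁻¹ ≤ max C84raw 0 * (Real.log D ^ 6)⁻¹ := by
      rw [ell]; exact mul_le_mul_of_nonneg_right (le_max_left _ _) (by positivity)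
    exact mul_le_mul_of_nonneg_right this (by positivity)
  have h84good : ∀ d r : ℕ, 1 ≤ d → 1 ≤ r →
      ((d * r : ℕ) : ℝ) < Real.exp ((θ₀ - 2 * Real.log D ^ (11 / 10 : ℝ) / Real.log D ^ 9) * Real.log D ^ 9) →
      ∀ y : ℝ, bigT D < y → y < bigP D →
      ‖(∑ n ∈ Finset.Ico 1 ⌈y⌉₊, χ (n : ZMod D) * xiZero c' D j n d r / (n : ℂ) *
            ((y / n : ℝ) : ℂ) ^ (-betaMu D 6) * (Real.log (y / n) : ℂ)) -
          deriv χ.LFunction 1 * PiW χ d r * frakgW c' D j 6 y‖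
        ≤ max C84raw 0 * (Real.log D ^ 6)⁻¹ * (∏ q ∈ (d * r).primeFactors, (1 - (q : ℝ)⁻¹)⁻¹) ^ 2 :=
    fun d r hd1 hr1 hdr => h84all d r hd1 hr1 ((le_of_lt hdr).trans hYX)
  -- the `ξ₀` log-means up to `e^{τ₁Λ} = T²`
  have hΞ : ∀ d r : ℕ, ∀ y : ℝ, 1 ≤ y →
      y ≤ Real.exp (2 * Real.log D ^ (11 / 10 : ℝ) / Real.log D ^ 9 * Real.log D ^ 9) →
      ∑ n ∈ Finset.Ico 1 ⌈y⌉₊, ‖xiZero c' D j n d r‖ / n ≤ Cξ * (1 + 2 * Real.log D ^ (11 / 10 : ℝ)) ^ 3 := by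
    intro d r y hy1 hyτ
    have hτΛ : 2 * Real.log D ^ (11 / 10 : ℝ) / Real.log D ^ 9 * Real.log D ^ 9 = 2 * Real.log D ^ (11 / 10 : ℝ) :=
      div_mul_cancel₀ _ hΛ0.ne'
    have hlogy : Real.log y ≤ 2 * Real.log D ^ (11 / 10 : ℝ) := by
      rw [← hτΛ, ← Real.log_exp (2 * Real.log D ^ (11 / 10 : ℝ) / Real.log D ^ 9 * Real.log D ^ 9)]
      exact Real.log_le_log (by linarith only [hy1]) hyτ
    have h := hξD j d r y hy1 (hlogy.trans h2L)
    refine h.trans ?_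
    have hlog0 : 0 ≤ Real.log y := Real.log_nonneg hy1
    gcongr
  have hΞ0 : 0 ≤ Cξ * (1 + 2 * Real.log D ^ (11 / 10 : ℝ)) ^ 3 := by positivity
  -- (1) exact split of `S_j`
  have hYK : ⌈Real.exp ((θ₀ - 2 * Real.log D ^ (11 / 10 : ℝ) / Real.log D ^ 9) * Real.log D ^ 9)⌉₊
      ≤ ⌈Real.exp (θ₀ * Real.log D ^ 9)⌉₊ := Nat.ceil_mono hYX
  have hY1N : 1 ≤ ⌈Real.exp ((θ₀ - 2 * Real.log D ^ (11 / 10 : ℝ) / Real.log D ^ 9) * Real.log D ^ 9)⌉₊ :=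
    Nat.one_le_iff_ne_zero.mpr (Nat.pos_iff_ne_zero.mp (Nat.ceil_pos.mpr (by linarith only [hY2])))
  have hKN : ⌈Real.exp (θ₀ * Real.log D ^ 9)⌉₊ ≤ Nsupp D := Nat.ceil_le.mpr hθ0N.le
  have hvan0 : (∀ y : ℝ, θ₀ ≤ y → u y = 0) ∨ (∀ y : ℝ, θ₀ ≤ y → v y = 0) := by
    rcases le_total θu θv with h | h
    · left; intro y hy; exact huvan y (by rw [hmin, min_eq_left h] at hy; exact hy)
    · right; intro y hy; exact hvvan y (by rw [hmin, min_eq_right h] at hy; exact hy)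
  have hS := Sj_pair_eq_split c' hq j hvan0 hℓ0 hY1N hYK (Nat.le_ceil _) hKN
  -- (2) the good range
  have hgood := good_range_pair_bound c' χ hq hp j hL3 hA' hθ0.le h0u h0v hθu1.le hθv1 hu hu' hu'' hdWu hdWu' huvan
    hv hv' hv'' hdWv hdWv' hvvan hB00 hB10 hB20 hB0u hB1u hB2u hB0v hB1v hB2v hθuN hθvN hY1 hC840 hΞ0 h84good
    (fun d r _ _ _ => hΞ d r)
  -- (3) the sliver
  have hsliver := sliverPair_bound c' χ hq hp j hL3 hA' hmin hθu1 hθv1 hu hu' hu'' hdWu hdWu' huvan hv hv' hv''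
    hdWv hdWv' hvvan hB00 hB10 hB20 hB0u hB1u hB2u hB0v hB1v hB2v hBuz hBvz hθuN hθvN hY1 hgapB hgapC hC840 hCξ0
    h84all hΞ
  rw [← hKSdef] at hsliver
  -- (4) the collapse by (8.10)
  have hMD := mainDouble_pair_eq c' χ hq j u u' v v' θv
    ⌈Real.exp ((θ₀ - 2 * Real.log D ^ (11 / 10 : ℝ) / Real.log D ^ 9) * Real.log D ^ 9)⌉₊
  -- (5) the engine
  obtain ⟨hFd, hFM, hFM'⟩ := pairEngine_bounds (γ := betaJ c' D j * Real.log D ^ 9) (σ := sigmaJ c' D j)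
    (ν := nuJ c' D j) h0u h0v hv hdu hdu' hdv hdv' hB0u hB1u hB2u hB0v hB1v hB2v hΛ0 hlogY1
  have hM0 : 0 ≤ (‖betaJ c' D j * Real.log D ^ 9‖ * B₀ + B₁)
      * (B₁ + ‖sigmaJ c' D j‖ * B₀ + ‖nuJ c' D j‖ * (B₀ * θv)) := by positivity
  have hM'0 : 0 ≤ ((‖betaJ c' D j * Real.log D ^ 9‖ * B₁ + B₂) * (B₁ + ‖sigmaJ c' D j‖ * B₀ + ‖nuJ c' D j‖ * (B₀ * θv))
      + (‖betaJ c' D j * Real.log D ^ 9‖ * B₀ + B₁) * (B₂ + ‖sigmaJ c' D j‖ * B₁ + ‖nuJ c' D j‖ * B₀))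
        / Real.log D ^ 9 := by positivity
  have heng' := hengD j hj _ _ _ _ hY2 hYP hM0 hM'0 hFd hFM hFM'
  -- (6) the substitution and the split of the main integral
  have hsub := integral_pairEngine_eq (γ := betaJ c' D j * Real.log D ^ 9) (σ := sigmaJ c' D j)
    (ν := nuJ c' D j) (θv := θv) (u := u) (u' := u') (v := v) (v' := v') hΛ0
    (θ₀ - 2 * Real.log D ^ (11 / 10 : ℝ) / Real.log D ^ 9)
  have hbmem : θ₀ - 2 * Real.log D ^ (11 / 10 : ℝ) / Real.log D ^ 9 ∈ Icc 0 θ₀ :=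
    ⟨by linarith only [hτθ, hθ0], by linarith only [hτ0]⟩
  obtain ⟨hsplit2, htail⟩ := integral_pairProfile_split (γ := betaJ c' D j * Real.log D ^ 9) (σ := sigmaJ c' D j)
    (ν := nuJ c' D j) hθ0.le h0u h0v hu hu' hv hv' hB0u hB1u hB0v hB1v hbmem
  -- (7) the jets and the `[0,1]` vs `[0,θ₀]` integral
  have hk0 := integral_k0_pair_eq (j := j) (s := Repair.bS j) (N := Repair.bN j) hmin hθ0.le hθu1.le hθv1.le hu hu'
    hv hv' huvan huvan' hvvan hvvan'
  -- (8) the scalars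
  have hα : alpha D = π / Real.log D ^ 9 := by rw [alpha, bigP, Real.log_exp]; rfl
  have hαpos : 0 < alpha D := by rw [hα]; positivity
  have hαΛr : alpha D * Real.log D ^ 9 = π := by rw [hα]; field_simp
  have hαΛ : ((alpha D : ℝ) : ℂ)⁻¹ * ((Real.log D ^ 9 : ℝ) : ℂ)⁻¹ = (((1 / π : ℝ)) : ℂ) := by
    rw [← mul_inv, ← Complex.ofReal_mul, hαΛr, Complex.ofReal_div, Complex.ofReal_one, one_div]
  have hΛΛ : ((Real.log D ^ 9 : ℝ) : ℂ)⁻¹ * ((Real.log D ^ 9 : ℝ) : ℂ) = 1 :=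
    inv_mul_cancel₀ (by exact_mod_cast hΛ0.ne')
  have hm : sjPairMain j u u' v v' = -(((1 / π : ℝ)) : ℂ) *
      ∫ z in (0:ℝ)..1, k0jet j u u' z * k0mass (Repair.bS j) (Repair.bN j) (fun t => conj (v t)) (fun t => conj (v' t)) z :=
    rfl
  -- (9) the identity
  have hid := final_identity (a := ((frakA χ : ℝ) : ℂ)) hS hMD hsub hsplit2 hk0 hm hαΛ hΛΛ
  rw [hid]
  -- (10) the five bounds
  have nαi : ‖((alpha D : ℝ) : ℂ)⁻¹‖ = Real.log D ^ 9 / π := by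
    rw [norm_inv, Complex.norm_real, Real.norm_of_nonneg hαpos.le, hα, inv_div]
  have nΛi : ‖((Real.log D ^ 9 : ℝ) : ℂ)⁻¹‖ = (Real.log D ^ 9)⁻¹ := by
    rw [norm_inv, Complex.norm_real, Real.norm_of_nonneg hΛ0.le]
  have nπi : ‖(((1 / π : ℝ)) : ℂ)‖ = 1 / π := by
    rw [Complex.norm_real, Real.norm_of_nonneg (by positivity)]
  have na : ‖((frakA χ : ℝ) : ℂ)‖ = frakA χ := by rw [Complex.norm_real, Real.norm_of_nonneg hfrakA0]
  -- T1
  have hERR := errGood_le c' χ hp hL3 j hB00 hB10 hB20 hC840 hCξ0 hθv0.le (θ := θv) (Cξ := Cξ)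
  rw [← hKEdef] at hERR
  have T1 : ‖((alpha D : ℝ) : ℂ)⁻¹ * ((∑ n ∈ Finset.Ico 1
      ⌈Real.exp ((θ₀ - 2 * Real.log D ^ (11 / 10 : ℝ) / Real.log D ^ 9) * Real.log D ^ 9)⌉₊,
        ∑ p ∈ Nat.divisorsAntidiagonal n, sjWeight c' χ j p * (psiSum c' D χ j u n * antiSum c' D χ j v p.1 p.2))
      - ∑ n ∈ Finset.Ico 1 ⌈Real.exp ((θ₀ - 2 * Real.log D ^ (11 / 10 : ℝ) / Real.log D ^ 9) * Real.log D ^ 9)⌉₊,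
        ∑ p ∈ Nat.divisorsAntidiagonal n,
          sjWeight c' χ j p * (psiMain c' D χ j u u' n * antiMain c' D χ j v v' θv p))‖ ≤ ε / 5 * frakA χ := by
    rw [norm_mul, nαi]
    have hlogY : Real.log (Real.exp ((θ₀ - 2 * Real.log D ^ (11 / 10 : ℝ) / Real.log D ^ 9) * Real.log D ^ 9))
        ≤ Real.log D ^ 9 := by
      rw [Real.log_exp, sub_mul]
      have h1 : θ₀ * Real.log D ^ 9 ≤ 1 * Real.log D ^ 9 := mul_le_mul_of_nonneg_right hθ01.le hΛ0.le
      linarith only [mul_nonneg hτ0 hΛ0.le, h1]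
    have hlogY0 : 0 ≤ Real.log (Real.exp ((θ₀ - 2 * Real.log D ^ (11 / 10 : ℝ) / Real.log D ^ 9) * Real.log D ^ 9)) := by
      rw [Real.log_exp]
      exact mul_nonneg (by linarith only [hτθ, hθ0]) hΛ0.le
    have hE0 : 0 ≤ errGood c' D j B₀ B₁ B₂ (max C84raw 0) (Cξ * (1 + 2 * Real.log D ^ (11 / 10 : ℝ)) ^ 3)
        ‖deriv χ.LFunction 1‖ θv := by
      unfold errGood deltaM0 deltaN0 antiK0 psiJ0; positivity
    have h1 := goodTerm_le hℓ1 hE0 hlogY hlogY0 hgood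
    refine h1.trans ?_
    calc 4 * Real.exp 430 / π * errGood c' D j B₀ B₁ B₂ (max C84raw 0)
          (Cξ * (1 + 2 * Real.log D ^ (11 / 10 : ℝ)) ^ 3) ‖deriv χ.LFunction 1‖ θv
        ≤ 4 * Real.exp 430 / π * (KE / Real.log D) := mul_le_mul_of_nonneg_left hERR (by positivity)
      _ = 4 * Real.exp 430 / π * KE / Real.log D := by ring
      _ ≤ ε / 5 * a₀ := div_le_of_div_le' hεa hℓ0 hT1
      _ ≤ ε / 5 * frakA χ := by gcongr
  -- T2
  have T2 : ‖((alpha D : ℝ) : ℂ)⁻¹ * ∑ n ∈ Finset.Ico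
      ⌈Real.exp ((θ₀ - 2 * Real.log D ^ (11 / 10 : ℝ) / Real.log D ^ 9) * Real.log D ^ 9)⌉₊
      ⌈Real.exp (θ₀ * Real.log D ^ 9)⌉₊,
        ∑ p ∈ Nat.divisorsAntidiagonal n, sjWeight c' χ j p * (psiSum c' D χ j u n * antiSum c' D χ j v p.1 p.2)‖
      ≤ ε / 5 * frakA χ := by
    rw [norm_mul, nαi]
    refine hsliver.trans ?_
    calc KS / Real.log D ≤ ε / 5 * a₀ := div_le_of_div_le' hεa hℓ0 hT2
      _ ≤ ε / 5 * frakA χ := by gcongr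
  -- T3
  have T3 : ‖((alpha D : ℝ) : ℂ)⁻¹ * ((Real.log D ^ 9 : ℝ) : ℂ)⁻¹ ^ 2 *
      (deriv χ.LFunction 1 ^ 2 *
          (∑ n ∈ Finset.Ico 1 ⌈Real.exp ((θ₀ - 2 * Real.log D ^ (11 / 10 : ℝ) / Real.log D ^ 9) * Real.log D ^ 9)⌉₊,
            (‖χ (n : ZMod D)‖ : ℂ) * lamZero c' D j n / (Nat.totient n : ℂ) *
              pairEngine (betaJ c' D j * Real.log D ^ 9) (sigmaJ c' D j) (nuJ c' D j) θv u u' v v' (Real.log D ^ 9) n)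
        - (frakA χ : ℂ) * ∫ t in (1:ℝ)..Real.exp ((θ₀ - 2 * Real.log D ^ (11 / 10 : ℝ) / Real.log D ^ 9) * Real.log D ^ 9),
            pairEngine (betaJ c' D j * Real.log D ^ 9) (sigmaJ c' D j) (nuJ c' D j) θv u u' v v'
              (Real.log D ^ 9) t / t)‖
      ≤ ε / 5 * frakA χ := by
    rw [norm_mul, norm_mul, nαi, norm_pow, nΛi, inv_pow, mul_assoc]
    have hMle : (‖betaJ c' D j * Real.log D ^ 9‖ * B₀ + B₁) * (B₁ + ‖sigmaJ c' D j‖ * B₀ + ‖nuJ c' D j‖ * (B₀ * θv))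
        ≤ (Gbound c' * B₀ + B₁) * (B₁ + 2 * Gbound c' * B₀ + Gbound c' ^ 2 * (B₀ * θv)) := by
      have h1 := norm_betaJ_mul_le c' hL3 j
      have h2 := norm_sigmaJ_le c' hL3 j
      have h3 := norm_nuJ_le c' hL3 j
      gcongr
    have hM'le : ((‖betaJ c' D j * Real.log D ^ 9‖ * B₁ + B₂) * (B₁ + ‖sigmaJ c' D j‖ * B₀ + ‖nuJ c' D j‖ * (B₀ * θv))
        + (‖betaJ c' D j * Real.log D ^ 9‖ * B₀ + B₁) * (B₂ + ‖sigmaJ c' D j‖ * B₁ + ‖nuJ c' D j‖ * B₀))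
          / Real.log D ^ 9 * Real.log D ^ 9
        ≤ (Gbound c' * B₁ + B₂) * (B₁ + 2 * Gbound c' * B₀ + Gbound c' ^ 2 * (B₀ * θv))
          + (Gbound c' * B₀ + B₁) * (B₂ + 2 * Gbound c' * B₁ + Gbound c' ^ 2 * B₀) := by
      rw [div_mul_cancel₀ _ hΛ0.ne']
      have h1 := norm_betaJ_mul_le c' hL3 j
      have h2 := norm_sigmaJ_le c' hL3 j
      have h3 := norm_nuJ_le c' hL3 j
      gcongr
    simp only [ell] at heng'
    have h1 := engineTerm_le hℓ1 hM0 hMle hM'0 hM'le heng'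
    rw [← hKengdef] at h1
    refine h1.trans ?_
    have hℓ3 : Real.log D ≤ Real.log D ^ 3 := by
      calc Real.log D = Real.log D ^ 1 := (pow_one _).symm
        _ ≤ Real.log D ^ 3 := pow_le_pow_right₀ hℓ1 (by norm_num)
    calc Keng / Real.log D ^ 3 ≤ Keng / Real.log D := div_le_div_of_nonneg_left hKeng0 hℓ0 hℓ3
      _ ≤ ε / 5 * a₀ := div_le_of_div_le' hεa hℓ0 hT3
      _ ≤ ε / 5 * frakA χ := by gcongr
  -- T4
  have T4 : ‖(((1 / π : ℝ)) : ℂ) * (frakA χ : ℂ) *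
      ((∫ z in (0:ℝ)..θ₀, pairProfile (betaJ c' D j * Real.log D ^ 9) (sigmaJ c' D j) (nuJ c' D j) θv u u' v v' z)
        - ∫ z in (0:ℝ)..θ₀, k0jet j u u' z * k0mass (Repair.bS j) (Repair.bN j) (fun t => conj (v t))
            (fun t => conj (v' t)) z)‖ ≤ ε / 5 * frakA χ := by
    rw [norm_mul, norm_mul, nπi, na]
    have hi1 := intervalIntegrable_pairProfile (γ := betaJ c' D j * Real.log D ^ 9) (σ := sigmaJ c' D j)
      (ν := nuJ c' D j) hθ0.le h0u h0v hu hu' hv hv' (a := 0) (b := θ₀) ⟨le_rfl, hθ0.le⟩ ⟨hθ0.le, le_rfl⟩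
    rw [← intervalIntegral.integral_sub hi1 ?hi2]
    case hi2 =>
      have hc1 : ContinuousOn (fun y => conj (v y)) (Icc 0 1) :=
        Complex.continuous_conj.comp_continuousOn (continuousOn_Icc_one_of_short hv hvvan)
      have htailc : ContinuousOn (fun z => ∫ t in z..1, conj (v t)) (Icc 0 1) := by
        have hint : IntegrableOn (fun x => conj (v x)) (Set.uIcc 0 1) volume := by
          rw [Set.uIcc_of_le zero_le_one]; exact hc1.integrableOn_compact isCompact_Icc
        have h := intervalIntegral.continuousOn_primitive_interval_left hint
        rwa [Set.uIcc_of_le zero_le_one] at h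
      have hK0 : ContinuousOn (fun z => k0mass (Repair.bS j) (Repair.bN j) (fun t => conj (v t)) (fun t => conj (v' t)) z)
          (Icc 0 θv) := by
        unfold k0mass
        exact ((continuousOn_const.mul (htailc.mono (Icc_subset_Icc le_rfl hθv1.le))).add
          (continuousOn_const.mul (Complex.continuous_conj.comp_continuousOn hv))).sub
          (Complex.continuous_conj.comp_continuousOn hv')
      have hJ0 : ContinuousOn (k0jet j u u') (Icc 0 θu) := by
        unfold k0jet; exact hu'.add (continuousOn_const.mul hu)
      exact ContinuousOn.intervalIntegrable (by
        rw [Set.uIcc_of_le hθ0.le]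
        exact (hJ0.mono (Icc_subset_Icc le_rfl h0u)).mul (hK0.mono (Icc_subset_Icc le_rfl h0v)))
    have h1 := jetTerm_pair_le c' hL3 hj hθ0.le h0u h0v hv hvvan hθv1.le hB00 hB0u hB1u hB0v hB1v
    rw [← hKjetdef] at h1
    have h2 : 1 / π * ‖∫ z in (0:ℝ)..θ₀, (pairProfile (betaJ c' D j * Real.log D ^ 9) (sigmaJ c' D j) (nuJ c' D j) θv
        u u' v v' z
        - k0jet j u u' z * k0mass (Repair.bS j) (Repair.bN j) (fun t => conj (v t)) (fun t => conj (v' t)) z)‖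
        ≤ ε / 5 := by
      exact h1.trans (div_le_of_div_le' hε5 hℓ0 hT4)
    calc 1 / π * frakA χ * _ = frakA χ * (1 / π * _) := by ring
      _ ≤ frakA χ * (ε / 5) := mul_le_mul_of_nonneg_left h2 hfrakA0
      _ = ε / 5 * frakA χ := by ring
  -- T5
  have T5 : ‖(((1 / π : ℝ)) : ℂ) * (frakA χ : ℂ) *
      ∫ z in (θ₀ - 2 * Real.log D ^ (11 / 10 : ℝ) / Real.log D ^ 9)..θ₀,
        pairProfile (betaJ c' D j * Real.log D ^ 9) (sigmaJ c' D j) (nuJ c' D j) θv u u' v v' z‖ ≤ ε / 5 * frakA χ := by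
    rw [norm_mul, norm_mul, nπi, na]
    have htail' : ‖∫ z in (θ₀ - 2 * Real.log D ^ (11 / 10 : ℝ) / Real.log D ^ 9)..θ₀,
        pairProfile (betaJ c' D j * Real.log D ^ 9) (sigmaJ c' D j) (nuJ c' D j) θv u u' v v' z‖
        ≤ (Real.log D ^ (11 / 10 : ℝ) * 2 / Real.log D ^ 9) *
          ((Gbound c' * B₀ + B₁) * (B₁ + 2 * Gbound c' * B₀ + Gbound c' ^ 2 * (B₀ * θv))) := by
      refine htail.trans ?_
      have e : θ₀ - (θ₀ - 2 * Real.log D ^ (11 / 10 : ℝ) / Real.log D ^ 9)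
          = Real.log D ^ (11 / 10 : ℝ) * 2 / Real.log D ^ 9 := by ring
      rw [e]
      have h1 := norm_betaJ_mul_le c' hL3 j
      have h2 := norm_sigmaJ_le c' hL3 j
      have h3 := norm_nuJ_le c' hL3 j
      gcongr
    have h1 := tailTerm_le hℓ1 (by positivity : 0 ≤ Gbound c' * B₀ + B₁)
      (by positivity : 0 ≤ B₁ + 2 * Gbound c' * B₀ + Gbound c' ^ 2 * (B₀ * θv)) htail'
    rw [← hKtaildef] at h1
    have h2 : 1 / π * ‖∫ z in (θ₀ - 2 * Real.log D ^ (11 / 10 : ℝ) / Real.log D ^ 9)..θ₀,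
        pairProfile (betaJ c' D j * Real.log D ^ 9) (sigmaJ c' D j) (nuJ c' D j) θv u u' v v' z‖ ≤ ε / 5 := by
      exact h1.trans (div_le_of_div_le' hε5 hℓ0 hT5)
    calc 1 / π * frakA χ * _ = frakA χ * (1 / π * _) := by ring
      _ ≤ frakA χ * (ε / 5) := mul_le_mul_of_nonneg_left h2 hfrakA0
      _ = ε / 5 * frakA χ := by ring
  -- sum
  calc _ ≤ ‖((alpha D : ℝ) : ℂ)⁻¹ * (_ - _) + ((alpha D : ℝ) : ℂ)⁻¹ * _
          - ((alpha D : ℝ) : ℂ)⁻¹ * ((Real.log D ^ 9 : ℝ) : ℂ)⁻¹ ^ 2 * (_ - _)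
          - (((1 / π : ℝ)) : ℂ) * (frakA χ : ℂ) * (_ - _)‖
        + ‖(((1 / π : ℝ)) : ℂ) * (frakA χ : ℂ) * _‖ := norm_add_le _ _
    _ ≤ (‖((alpha D : ℝ) : ℂ)⁻¹ * (_ - _) + ((alpha D : ℝ) : ℂ)⁻¹ * _
          - ((alpha D : ℝ) : ℂ)⁻¹ * ((Real.log D ^ 9 : ℝ) : ℂ)⁻¹ ^ 2 * (_ - _)‖
          + ‖(((1 / π : ℝ)) : ℂ) * (frakA χ : ℂ) * (_ - _)‖) + _ := by
        gcongr; exact norm_sub_le _ _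
    _ ≤ ((‖((alpha D : ℝ) : ℂ)⁻¹ * (_ - _) + ((alpha D : ℝ) : ℂ)⁻¹ * _‖
          + ‖((alpha D : ℝ) : ℂ)⁻¹ * ((Real.log D ^ 9 : ℝ) : ℂ)⁻¹ ^ 2 * (_ - _)‖) + _) + _ := by
        gcongr; exact norm_sub_le _ _
    _ ≤ (((‖((alpha D : ℝ) : ℂ)⁻¹ * (_ - _)‖ + ‖((alpha D : ℝ) : ℂ)⁻¹ * _‖) + _) + _) + _ := by
        gcongr; exact norm_add_le _ _
    _ ≤ (((ε / 5 * frakA χ + ε / 5 * frakA χ) + ε / 5 * frakA χ) + ε / 5 * frakA χ) + ε / 5 * frakA χ := by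
        gcongr
    _ = ε * frakA χ := by ring

end Literature.NumberTheory.LFunctions.Zhang2022.DipoleRule

end
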